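import Literature.NumberTheory.EllipticCurves.ComplexMultiplicationBurungaleFlachSevenLeavesProofs
import Literature.NumberTheory.EllipticCurves.ComplexMultiplicationDeuringHoldsProofs
import HarnessLib

/-!
# The Burungale–Flach descent (Cor. 1 at `F = K` ⇒ Cor. 2 at `F⁺ = ℚ`) from three leaves

Sibling *proofs* file (D-0014 append protocol: a new file, theorems only, no definition, no
named fact introduced or restated) of
`Literature.NumberTheory.EllipticCurves.ComplexMultiplicationBurungaleFlachDescent`, for its
named fact

> `Literature.NumberTheory.EllipticCurves.BurungaleFlach2024_bsd_rat_of_bsd_cmField` — for `E/ℚ`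
> with CM by `𝓞_K` (`j(E) ∈ maximalCMJInvariants`), `L(E, 1) ≠ 0`, `K` its CM field and `W'` a
> globally minimal model of `E_K`: the rank-zero Birch–Swinnerton-Dyer statement for `E_K/K`
> implies the rank-zero Birch–Swinnerton-Dyer statement for `E/ℚ` (Burungale–Flach, Camb. J.
> Math. 12 (2024), proof of Cor. 2 at `F⁺ = ℚ`, `F = K`, arXiv p. 4: *"there is an isogeny of
> abelian surfaces `Res^F_{F⁺} E ∼ E × E_ε` … `E_ε` is isogenous to `E` … the BSD conjecture is
> invariant under isogeny and compatible with Weil restriction [Milne 1972, Thm. 1]"*, and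
> *"Any CM elliptic curve `E/ℚ` with `L(E/ℚ,1) ≠ 0` satisfies the assumptions of Corollary 2"*).

History of the reduction in the tree: level 3 (`…DescentProofs`: modularity, Artin formalism,
Milne, Cassels, Knapp 11.67, `L(E,1) ≥ 0`, the CM twist isogeny), level 5
(`…DescentDeuringProofs`: the Deuring–Hecke continuation `hH`, Deuring's identity `hD`, Milne
`hBC`, Cassels `hISO`, `L(E,1) ≥ 0` `hPOS`), level 6 (`…SevenLeavesProofs`,
`BurungaleFlach2024_bsd_rat_of_bsd_cmField_of_level6`: `hH` removed). Deuring's identity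
`L(E_K/K, s) = L(E/ℚ, s)²` is now a theorem of the tree
(`Deuring_LFunction_baseChange_cmField_holds`, `ComplexMultiplicationDeuringHoldsProofs`: Artin
formalism for quadratic base change, the CM twist isogeny `E ∼ E^{(d_K)}` and Knapp 11.67, all
three discharged), so:

* `BurungaleFlach2024_bsd_rat_of_bsd_cmField_of_three_leaves` (**proved**, the census of this
  fact): the descent fact follows, sorry-free, from exactly **three** named facts of
  `BSDQuadraticDescent.lean`, each a classical theorem stated for all elliptic curves over `ℚ` —
  1. `WeierstrassCurve.bsdRHS_baseChange_quadratic` (`hBC`) — Milne, Invent. Math. 17 (1972),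
     §1 Thm. 1 with §2, in the rank-zero quotient form of Dokchitser–Dokchitser 2010, proof of
     Thm. 8: the BSD quotient of `E_K/K` is the product of those of `E/ℚ` and `E^{(d_K)}/ℚ`;
  2. `WeierstrassCurve.bsdRHS_eq_of_isIsogenous` (`hISO`) — Cassels 1965 / Milne *ADT* I.7.3:
     the BSD quotient `#Ш · Reg · Ω · ∏ c_p / #E(ℚ)_tors²` is a `ℚ`-isogeny invariant;
  3. `WeierstrassCurve.re_entireLFunction_one_nonneg` (`hPOS`) — `L(E, 1) ≥ 0` (Guo 1996;
     Lapid–Rallis 2003, Thm. 1 for `n = 2`), the sign when "taking square roots".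
  None of the three is in reach of Mathlib (pin v4.32.0) or the tree today: (1) and (2) rest on
  the Cassels–Tate pairing, Tate local duality, Poitou–Tate and the global Euler characteristic
  (Milne *ADT* I.§6–7; cf. the module docstring of `ComplexMultiplicationBSDTripleIsogenyProofs`),
  (3) on modularity and the relative trace formula / Kohnen–Zagier–Waldspurger.
* `BurungaleFlach2024_bsd_rat_of_corOne_of_three_leaves` (**proved**): hence Corollary 2 over
  `ℚ` (`BurungaleFlach2024_bsd_rat`: rank-zero BSD for `E/ℚ` with CM by `𝓞_K` and `L(E,1) ≠ 0`)
  from Corollary 1 at `F = K` (`BurungaleFlach2024_bsd_cmField`) and the same three leaves, by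
  the level-2 assembly `BurungaleFlach2024_bsd_rat_of_level2`.

When the three leaves are discharged, the discharge of the fact is the term
`BurungaleFlach2024_bsd_rat_of_bsd_cmField_of_three_leaves hBC_holds hISO_holds hPOS_holds`.

## References

* A. Burungale, M. Flach, *The conjecture of Birch and Swinnerton-Dyer for certain elliptic curves
  with complex multiplication*, Camb. J. Math. 12 (2024), no. 2 (arXiv:2206.09874): Cor. 1,
  Cor. 2 and its proof, and the sentence following it (arXiv pp. 3–4). [BurungaleFlach2024]
* J. S. Milne, *On the arithmetic of abelian varieties*, Invent. Math. 17 (1972), 177–190: §1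
  Thm. 1, §2, Thm. 3 and Corollary. [Milne1972ArithmeticAV]
* J. W. S. Cassels, *Arithmetic on curves of genus 1. VIII*, J. reine angew. Math. 217 (1965).
  [Cassels1965ArithmeticVIII]
* E. Lapid, S. Rallis, *On the nonnegativity of `L(1/2, π)` for `SO_{2n+1}`*, Ann. of Math. 157
  (2003), Thm. 1. [LapidRallis2003]
* J. H. Silverman, *Advanced Topics in the Arithmetic of Elliptic Curves* (1994), Ch. II
  Thm. 10.5 (Deuring; the leaf discharged upstream). [SilvermanATAEC1994]
-/

noncomputable section

open WeierstrassCurve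

namespace Literature.NumberTheory.EllipticCurves

/-- **The descent fact from Milne, Cassels and the sign of `L(E,1)` — three leaves.**
`BurungaleFlach2024_bsd_rat_of_bsd_cmField` (rank-zero BSD for `E_K/K` ⇒ rank-zero BSD for
`E/ℚ`, for `E/ℚ` with CM by `𝓞_K` and `L(E,1) ≠ 0`; Burungale–Flach 2024, proof of Cor. 2 at
`F⁺ = ℚ`) follows from Milne's theorem on the BSD quotient under quadratic base change (`hBC`),
Cassels' isogeny invariance of the BSD quotient (`hISO`) and `L(E,1) ≥ 0` (`hPOS`): level 6
(`BurungaleFlach2024_bsd_rat_of_bsd_cmField_of_level6`) with its Deuring hypothesis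
`L(E_K/K, s) = L(E/ℚ, s)²` supplied by the theorem `Deuring_LFunction_baseChange_cmField_holds`.
The chain inside: `E(ℚ) ↪ E(K)` finite; `Ш(E/ℚ) → Ш(E_K/K)` has finite kernel;
`L(E_K/K,1) = L(E,1)²` (Deuring, with `L(E,1) ≠ 0`); Milne: `L(E,1)²/… = RHS(E)·RHS(E^{(d_K)})`;
Cassels along the CM twist isogeny `E ∼ E^{(d_K)}` (a theorem): `RHS(E^{(d_K)}) = RHS(E)`; so
`L(E,1)² = RHS(E)²` with `RHS(E) > 0`, and `L(E,1) ≥ 0` picks the sign.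
[cite: BurungaleFlach2024, proof of Cor. 2 and the sentence following it (arXiv p. 4)]
[cite: Milne1972ArithmeticAV, §1 Thm. 1, Thm. 3 and Corollary (through BurungaleFlach2024)] -/
theorem BurungaleFlach2024_bsd_rat_of_bsd_cmField_of_three_leaves
    (hBC : bsdRHS_baseChange_quadratic) (hISO : bsdRHS_eq_of_isIsogenous)
    (hPOS : re_entireLFunction_one_nonneg) : BurungaleFlach2024_bsd_rat_of_bsd_cmField :=
  BurungaleFlach2024_bsd_rat_of_bsd_cmField_of_level6 Deuring_LFunction_baseChange_cmField_holds
    hBC hISO hPOS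

/-- **Corollary 2 over `ℚ` from Corollary 1 over `K` and the three leaves** (Burungale–Flach
2024, Cor. 2 for `F⁺ = ℚ`: rank-zero BSD for `E/ℚ` with CM by `𝓞_K` and `L(E,1) ≠ 0`): the
level-2 assembly fed with the three-leaf descent.
[cite: BurungaleFlach2024, Cor. 2 and its proof (arXiv p. 4)] -/
theorem BurungaleFlach2024_bsd_rat_of_corOne_of_three_leaves
    (h₁ : BurungaleFlach2024_bsd_cmField) (hBC : bsdRHS_baseChange_quadratic)
    (hISO : bsdRHS_eq_of_isIsogenous) (hPOS : re_entireLFunction_one_nonneg) :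
    BurungaleFlach2024_bsd_rat :=
  BurungaleFlach2024_bsd_rat_of_level2 h₁
    (BurungaleFlach2024_bsd_rat_of_bsd_cmField_of_three_leaves hBC hISO hPOS)

end Literature.NumberTheory.EllipticCurves

end
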